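import Summits.PneNP.PneNP.Theorems.SoloBlindStreamingOracle
import HarnessLib

/-!
# Streaming `MCSP[s]` with the size bound as data

Tools for THEOREM C (`SoloBlindTimeConstructible`: McKay–Murray–Williams Theorem 1.3 for every
time-constructible size bound, i.e. the tree's named fact `thm13` as a theorem).  THEOREM B
(`SoloBlindStreamingMagnification`) computed the size bound `s n` *on codes* inside the goodness
test and inside the first stage of the update machine, which is where its hypothesis
`CodeFP unE natE s` (computability of `s` in time `poly(n)` on `1ⁿ`) was consumed.  A merely
time-constructible `s` is computable on `1ⁿ` in time `c · s n + c`, which is polynomial in the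
*budget* `poly(s n)` of the update but not in `n`; so here the size bound becomes *data*:

* `AdmD m n D`, `cf_admD`: admissibility of an evaluator-program `D` with the bound `m` supplied as
  an argument (`AdmD (s n) n D = Adm s n D`), computed on codes with no reference to `s`;
* `exists_goodTestD`: under `NP ⊆ P`, ONE goodness test `G`, computed on codes, that reads the
  size bound off the padding — `G (s (log N) + 1) N j D b D' = Good s N j D b D'` for EVERY `s`
  (consistency with the current program is again one call to the polynomial-time indicator of the
  `NP` language `BAD` of `SoloBlindStreamingOracle`);
* `exists_selectorAt`: the search-to-decision selector at padding `P N ≥ s (log N)` for a goodness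
  test that agrees with `Good s` only *at that padding* (the hypothesis of `exists_selectorG`
  asked for agreement at every padding);
* `cf_pre1`, `cf_pre3`: the two code stages `u ↦ ⟨1^(log N), u⟩` and `⟨m, u⟩ ↦ ⟨ff, 1⁰, m + 1, u⟩`
  around the time-constructibility machine in the first stage of the update machine of THEOREM C.

References: D. M. McKay, C. D. Murray, R. R. Williams, *Weak lower bounds on resource-bounded
compression imply strong separations of complexity classes*, STOC 2019, Theorem 1.3 and §2;
S. Arora, B. Barak, *Computational Complexity: A Modern Approach*, 2009, §1.3, Def. 2.1, Thm. 2.18.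
-/

namespace Summit.PneNP.PneNP.Theorems.SoloBlind

open Computability Polynomial
open Literature.Computability.Complexity Literature.Computability.Complexity.CircEval
open Literature.Computability.Complexity.CodeFP (natE unE bitE pairE rawE strE unitE pairE_apply
  unE_eq_ones length_unE length_natE_le)
open Literature.Computability.MetaComplexity Literature.Computability.MetaComplexity.MCSPVerif
open Literature.Computability.MetaComplexity.McKayMurrayWilliams2019

namespace CStream

/-! ### Admissibility with the size bound as data -/

/-- The length bound `K` with the size bound as data: `KD m n = (m + 1)(8(n + m) + 10)`, so that
`K s n = KD (s n) n`. [folklore] -/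
def KD (m n : ℕ) : ℕ := (m + 1) * (8 * (n + m) + 10)

/-- Admissibility of an evaluator-program with the size bound `m` as data: clean, at most `m`
gate marks, `1 ≤ m`, length at most `KD m n`. [folklore] -/
def AdmD (m n : ℕ) (D : List Bool) : Bool :=
  isClean D && decide (tabCount D ≤ m) && decide (1 ≤ m) && decide (D.length ≤ KD m n)

/-- `AdmD (s n) n = Adm s n`. [folklore] -/
theorem admD_eq (s : ℕ → ℕ) (n : ℕ) (D : List Bool) : AdmD (s n) n D = Adm s n D := rfl

/-- Admissibility with the bound as data is computed on codes (input `⟨m, ⟨1ⁿ, D⟩⟩`).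
[cite: AroraBarak2009, §1.3] -/
theorem cf_admD : CodeFP (pairE natE (pairE unE strE)) bitE (fun p => AdmD p.1 p.2.1 p.2.2) := by
  have hClean : CodeFP strE bitE isClean :=
    CodeFP.of_fn cleanT.eval cleanT_mem_FP fun D => by
      show cleanT.eval D = [isClean D]
      exact cleanT_eval D
  have hTab : CodeFP strE unE tabCount :=
    CodeFP.of_fn tabMarksT.eval tabMarksT_mem_FP fun D => by
      show tabMarksT.eval D = unE (tabCount D)
      rw [tabMarksT_eval, unE_eq_ones]
  have hM : CodeFP (pairE natE (pairE unE strE)) natE (fun p => p.1) := CodeFP.fst _ _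
  have hN : CodeFP (pairE natE (pairE unE strE)) natE (fun p => p.2.1) :=
    (CodeFP.natOfUn.comp (CodeFP.snd _ _).fst').congr fun _ => rfl
  have hD : CodeFP (pairE natE (pairE unE strE)) strE (fun p => p.2.2) := (CodeFP.snd _ _).snd'
  have hK : CodeFP (pairE natE (pairE unE strE)) natE (fun p => KD p.1 p.2.1) :=
    (CodeFP.natMul.comp ((CodeFP.natAdd.comp (hM.pair (CodeFP.const _ 1))).pair
      (CodeFP.natAdd.comp ((CodeFP.natMul.comp ((CodeFP.const _ 8).pair
        (CodeFP.natAdd.comp (hN.pair hM)))).pair (CodeFP.const _ 10))))).congr fun _ => rfl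
  have h1 : CodeFP (pairE natE (pairE unE strE)) bitE (fun p => isClean p.2.2) := hClean.comp hD
  have h2 : CodeFP (pairE natE (pairE unE strE)) bitE (fun p => decide (tabCount p.2.2 ≤ p.1)) :=
    CodeFP.unLeNat.comp ((hTab.comp hD).pair hM)
  have h3 : CodeFP (pairE natE (pairE unE strE)) bitE (fun p => decide (1 ≤ p.1)) :=
    CodeFP.natLe.comp ((CodeFP.const _ 1).pair hM)
  have h4 : CodeFP (pairE natE (pairE unE strE)) bitE
      (fun p => decide (p.2.2.length ≤ KD p.1 p.2.1)) :=
    CodeFP.unLeNat.comp ((CodeFP.strLength.comp hD).pair hK)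
  exact (((h1.and h2).and h3).and h4).congr fun _ => rfl

/-! ### The data goodness test -/

/-- **The data goodness test.** Under `NP ⊆ P` there is ONE goodness test `G`, computed on codes
without reference to any size bound, that reads the size bound off the padding: at padding
`s (log N) + 1` it agrees with `Good s`, for every `s`.  Admissibility is `AdmD (P - 1)`, the value
on row `j` is evaluated directly, and consistency with the current program on the earlier rows is
one call to the polynomial-time indicator of the `NP` language `BAD` (disagreement on some earlier
row, certificate `t` in binary), which is in `P` by assumption.
[cite: McKayMurrayWilliams2019, Thm. 1.3 (proof: the P = NP oracle)]
[cite: AroraBarak2009, Def. 2.1] -/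
theorem exists_goodTestD (hNP : Nondeterministic.NP ⊆ Classes.P) :
    ∃ G : GTest, CodeFP (pairE instE strE) bitE
        (fun q => G q.1.1 q.1.2.1 q.1.2.2.1 q.1.2.2.2.1 q.1.2.2.2.2 q.2) ∧
      ∀ (s : ℕ → ℕ) N j D b D', G (s (Nat.log 2 N) + 1) N j D b D' = Good s N j D b D' := by
  -- the NP language BAD and its polynomial-time indicator
  obtain ⟨V, hV, hVspec⟩ := cf_disChk
  have hR : ({z | V z = (fun _ : List Bool => [true]) z} : Language Bool) ∈ Classes.P :=
    setOf_apply_eq_apply_mem_P hV (const_mem_FP [true])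
  set BAD : Language Bool := {w | ∃ y : List Bool, y.length ≤ (X : Polynomial ℕ).eval w.length ∧
    boolPair w y ∈ ({z | V z = (fun _ : List Bool => [true]) z} : Language Bool)} with hBAD
  have hNPmem : BAD ∈ Nondeterministic.NP := ⟨_, hR, X, fun w => Iff.rfl⟩
  have hPmem : BAD ∈ Classes.P := hNP hNPmem
  have hInd : CodeFP dE bitE (fun v => BAD.boolIndicator (dE v)) :=
    (CodeFP.of_fn _ (indicatorFn_mem_FP hPmem) (fun _ => rfl) :
      CodeFP strE bitE fun w => BAD.boolIndicator w).comp
      ((CodeFP.id dE).recodeOut (eγ := strE) (g' := fun v => dE v) fun _ => rfl)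
  have hmemR : ∀ (v : DIn) (y : List Bool),
      boolPair (dE v) y ∈ ({z | V z = (fun _ : List Bool => [true]) z} : Language Bool) ↔
        disChk v y = true := fun v y => by
    show V (pairE dE strE (v, y)) = [true] ↔ _
    rw [hVspec]
    show bitE _ = [true] ↔ _
    simp [bitE]
  have hSpec : ∀ n N j D D', BAD.boolIndicator (dE (n, N, j, D, D')) = true ↔
      ∃ t < j, t < N ∧ ev n D' t ≠ ev n D t := fun n N j D D' => by
    rw [← Set.mem_iff_boolIndicator]
    show (∃ y : List Bool, y.length ≤ (X : Polynomial ℕ).eval (dE (n, N, j, D, D')).length ∧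
      boolPair (dE (n, N, j, D, D')) y ∈
        ({z | V z = (fun _ : List Bool => [true]) z} : Language Bool)) ↔ _
    constructor
    · rintro ⟨y, -, hy⟩
      have h := (hmemR _ y).1 hy
      simp only [disChk, Bool.and_eq_true, decide_eq_true_eq, Bool.not_eq_true', beq_eq_false_iff_ne,
        ne_eq] at h
      exact ⟨bitsToNat y, h.1.1, h.1.2, h.2⟩
    · rintro ⟨t, htj, htN, hne⟩
      refine ⟨encodeNat t, ?_, (hmemR _ _).2 ?_⟩
      · rw [eval_X]
        refine le_trans ?_ (length_natE_le_length_dE (n, N, j, D, D'))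
        show (encodeNat t).length ≤ (encodeNat N).length
        rw [TM2Pass.length_encodeNat_eq_size, TM2Pass.length_encodeNat_eq_size]
        exact Nat.size_le_size htN.le
      · have ht : bitsToNat (encodeNat t) = t := bitsToNat_encodeNat t
        simp only [disChk, ht, Bool.and_eq_true, decide_eq_true_eq, Bool.not_eq_true',
          beq_eq_false_iff_ne, ne_eq]
        exact ⟨⟨htj, htN⟩, hne⟩
  -- the goodness test: the size bound is `P - 1`
  refine ⟨fun P N j D b D' => AdmD (P - 1) (Nat.log 2 N) D' &&
      !BAD.boolIndicator (dE (Nat.log 2 N, N, j, D, D')) && (ev (Nat.log 2 N) D' j == b), ?_, ?_⟩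
  · have hP : CodeFP (pairE instE strE) unE (fun q => q.1.1) := (CodeFP.fst _ _).fst'
    have hN : CodeFP (pairE instE strE) natE (fun q => q.1.2.1) := (CodeFP.fst _ _).snd'.fst'
    have hj : CodeFP (pairE instE strE) natE (fun q => q.1.2.2.1) :=
      (CodeFP.fst _ _).snd'.snd'.fst'
    have hD : CodeFP (pairE instE strE) strE (fun q => q.1.2.2.2.1) :=
      (CodeFP.fst _ _).snd'.snd'.snd'.fst'
    have hb : CodeFP (pairE instE strE) bitE (fun q => q.1.2.2.2.2) :=
      (CodeFP.fst _ _).snd'.snd'.snd'.snd'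
    have hD' : CodeFP (pairE instE strE) strE (fun q => q.2) := CodeFP.snd _ _
    have hn : CodeFP (pairE instE strE) unE (fun q => Nat.log 2 q.1.2.1) := cf_log.comp hN
    have hm : CodeFP (pairE instE strE) natE (fun q => q.1.1 - 1) :=
      (CodeFP.natOfUn.comp (cf_unPred.comp hP)).congr fun _ => rfl
    have c1 : CodeFP (pairE instE strE) bitE
        (fun q => AdmD (q.1.1 - 1) (Nat.log 2 q.1.2.1) q.2) :=
      (cf_admD.comp (hm.pair (hn.pair hD'))).congr fun _ => rfl
    have c2 : CodeFP (pairE instE strE) bitE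
        (fun q => !BAD.boolIndicator (dE (Nat.log 2 q.1.2.1, q.1.2.1, q.1.2.2.1, q.1.2.2.2.1, q.2))) :=
      (hInd.comp (hn.pair (hN.pair (hj.pair (hD.pair hD'))))).not
    have c3 : CodeFP (pairE instE strE) bitE
        (fun q => ev (Nat.log 2 q.1.2.1) q.2 q.1.2.2.1 == q.1.2.2.2.2) :=
      (CodeFP.beq CodeFP.bitE_injective).comp ((cf_ev.comp (hn.pair (hD'.pair hj))).pair hb)
    exact ((c1.and c2).and c3).congr fun _ => rfl
  · intro s N j D b D'
    show (AdmD (s (Nat.log 2 N) + 1 - 1) (Nat.log 2 N) D' &&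
      !BAD.boolIndicator (dE (Nat.log 2 N, N, j, D, D')) && (ev (Nat.log 2 N) D' j == b)) = _
    rw [Nat.add_sub_cancel, admD_eq, Bool.eq_iff_iff, good_iff]
    simp only [Bool.and_eq_true, Bool.not_eq_true', beq_iff_eq, and_assoc]
    have h2 : BAD.boolIndicator (dE (Nat.log 2 N, N, j, D, D')) = false ↔
        ∀ t < j, t < N → ev (Nat.log 2 N) D' t = ev (Nat.log 2 N) D t := by
      rw [Bool.eq_false_iff, ne_eq, hSpec]
      simp only [not_exists, not_and, ne_eq, not_not]
    rw [h2]

/-! ### The selector for a goodness test agreeing at one padding -/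

/-- **The selector at a given padding.** If `NP ⊆ P` and `G` is a goodness test computed on codes
that agrees with `Good s` at the padding `P N ≥ s (log N)`, there is `g ∈ FP` whose induced
selector at that padding returns a good successor program whenever one exists
(search-to-decision under `P = NP`, witness polynomial `4 (X + 1)²`).
[cite: AroraBarak2009, Thm. 2.18] [cite: McKayMurrayWilliams2019, Thm. 1.3 (proof)] -/
theorem exists_selectorAt {s : ℕ → ℕ} (hNP : Nondeterministic.NP ⊆ Classes.P)
    (hs : ∀ n, n ≤ s n) {G : GTest}
    (hGc : CodeFP (pairE instE strE) bitE
      (fun q => G q.1.1 q.1.2.1 q.1.2.2.1 q.1.2.2.2.1 q.1.2.2.2.2 q.2))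
    {P : ℕ → ℕ} (hGeq : ∀ N j D b D', G (P N) N j D b D' = Good s N j D b D')
    (hP : ∀ N, s (Nat.log 2 N) ≤ P N) :
    ∃ g ∈ FP, ∀ N j D b D₀, Good s N j D b D₀ = true →
      Good s N j D b (selAt g P N j D b) = true := by
  obtain ⟨Gf, hGf, hGfspec⟩ := hGc
  have hR : ({z | Gf z = (fun _ : List Bool => [true]) z} : Language Bool) ∈ Classes.P :=
    setOf_apply_eq_apply_mem_P hGf (const_mem_FP [true])
  obtain ⟨g, hg, hspec⟩ :=
    exists_searchFn_of_NP_subset_P hNP hR (4 * (X + 1) ^ 2 : Polynomial ℕ)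
  refine ⟨g, hg, fun N j D b D₀ hD₀ => ?_⟩
  have hmem : ∀ D' : List Bool,
      boolPair (instE (P N, N, j, D, b)) D' ∈ ({z | Gf z = (fun _ : List Bool => [true]) z} :
        Language Bool) ↔ Good s N j D b D' = true := fun D' => by
    show Gf (pairE instE strE ((P N, N, j, D, b), D')) = [true] ↔ _
    rw [hGfspec, ← hGeq]
    show bitE _ = [true] ↔ _
    simp [bitE]
  have hp : ∀ L : ℕ, (4 * (X + 1) ^ 2 : Polynomial ℕ).eval L = 4 * (L + 1) ^ 2 := fun L => by
    simp [eval_pow]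
  have hK : K s (Nat.log 2 N) ≤
      (4 * (X + 1) ^ 2 : Polynomial ℕ).eval (instE (P N, N, j, D, b)).length := by
    rw [hp]
    have h1 := K_le_sq' hs (Nat.log 2 N)
    have h2 := length_instE_ge' (P N) N j D b
    have h3 := hP N
    generalize (instE (P N, N, j, D, b)).length = L at h2 ⊢
    generalize K s (Nat.log 2 N) = k at h1 ⊢
    generalize s (Nat.log 2 N) = a at h1 h3
    have h4 : (2 * a + 2 + 1) ^ 2 ≤ (L + 1) ^ 2 := Nat.pow_le_pow_left (by omega) 2
    nlinarith [h4]
  have hlen : D₀.length ≤ (4 * (X + 1) ^ 2 : Polynomial ℕ).eval (instE (P N, N, j, D, b)).length :=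
    (length_le_of_good s hD₀).trans hK
  have h := (hspec (instE (P N, N, j, D, b)) ⟨D₀, hlen, (hmem D₀).2 hD₀⟩).2
  exact (hmem _).1 h

/-! ### The code stages around the time-constructibility machine -/

/-- `u = ⟨N, ⟨σ, b⟩⟩ ↦ ⟨1^(log N), u⟩`, on codes. [folklore] -/
theorem cf_pre1 : CodeFP uE (pairE unE uE) (fun u => (Nat.log 2 u.1, u)) :=
  ((cf_log.comp (CodeFP.fst _ _)).pair (CodeFP.id uE)).congr fun _ => rfl

/-- `⟨m, u⟩ ↦ ⟨ff, 1⁰, m + 1, u⟩` (the initial loop word for padding `m + 1`), on codes. [folklore] -/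
theorem cf_pre3 : CodeFP (pairE natE uE) wbE (fun v => (false, 0, v.1 + 1, v.2)) :=
  ((CodeFP.const _ false).pair ((CodeFP.const _ 0).pair
    ((CodeFP.natAdd.comp ((CodeFP.fst _ _).pair (CodeFP.const _ 1))).pair
      (CodeFP.snd _ _)))).congr fun _ => rfl

end CStream

end Summit.PneNP.PneNP.Theorems.SoloBlind
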